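import Summits.Ventures.CertifiedManyBodySolver.Observables.EtaPairingExclusionElectronDopedTwins
import Summits.Ventures.CertifiedManyBodySolver.Observables.EtaPairingExclusionWeakCouplingWindows
import HarnessLib

/-!
# η-PAIRING ODLRO EXCLUSION ON THE ELECTRON-DOPED SIDE, II: the mirrored WEAK-COUPLING WINDOWS at
# `n = 13/10, 5/4, 6/5, 9/8` (`t' = 0`)

HONEST FRAMING: exclusions in Yang's staggered `s`-wave (η) pair channel, where nobody expects order; NOTHING about `d`-wave
pairing or the uniform on-site channel; CTL/dictionary class; not a superconductivity verdict; no phase sentence. Crew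
hubbard-obs (D-0042), seat hubbard-obs-p1 (`prover-hubbard-obs-p1-g15-0`); part 5 of the g15 η files: the §1 generic mirror
of `EtaPairingExclusionElectronDopedTwins` applied to the one-body margins of `EtaPairingExclusionWeakCouplingWindows`
(`0.6183229 − (2/3)U` at `7/10`, `0.4846219 − U` at `3/4`, `0.3554350 − (3/2)U` at `4/5`, `0.1723948 − 3U` at `7/8`; kernel
Fermi-sea rows, no claim node). In each window every translation-invariant ground state of density `2 − m` has NO η-pairing
ODLRO, `Re ω(η†_Λ η_Λ) ≤ 64(|Λ'| − |Λ|)²/margin² + (1 − m)|Λ|`. ZERO compute; no definition; no `sorry`; no claim node.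

References: E. H. Lieb, PRL 62 (1989) 1201, proof of Thm 2 [LiebPRL1989]; C. N. Yang, PRL 63 (1989) 2144 [Yang1989];
O. Bratteli, D. W. Robinson, OAQSM 2 (1997) Prop. 5.3.19 [BratteliRobinsonII1997]; E. H. Lieb, F. Y. Wu, Physica A 321
(2003) 1, §7 [LiebWuPhysicaA2003].
-/

noncomputable section

namespace Summit.Ventures.CertifiedManyBodySolver.Observables

open Matrix Finset Filter Literature.MathematicalPhysics.QuantumLattice Literature.Probability.LatticeModels
open Literature.MathematicalPhysics.QuantumLattice.HubbardWave0 ThermodynamicLimit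
open scoped ComplexOrder Topology

/-! ### The mirrored weak-coupling windows at `n = 13/10, 5/4, 6/5, 9/8` -/

/-- **η-PAIRING ODLRO IS ABSENT IN THE MIRRORED WEAK-COUPLING WINDOW AT `n = 13 / 10`** (`0 ≤ U < 0.9274843`; the part-2 margin
`(0.6183229 : ℝ) - 2 / 3 * U` at density `7 / 10` transported by the generic mirror `etaPairing_exclusion_mirror`): `M⁻⁴ Re ω(η†η) → 0` and
`Re ω(η†_Λ η_Λ) ≤ 64(|Λ'| − |Λ|)²/margin² + (3 / 10)|Λ|`. [cite: Yang1989, eqs. (6)–(8)] [cite: BratteliRobinsonII1997, Prop. 5.3.19]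
[cite: LiebPRL1989, proof of Theorem 2] -/
theorem etaPairing_exclusion_n13o10_weakCoupling {U : ℝ} (hU : 0 ≤ U) (hUw : U < 0.9274843)
    {ω : InfVolFermionState 2} (hω : ω.IsTranslationInvariant) (hρ : ω.density = 13 / 10)
    (hme : ω.meanEnergy (hubbardTTPrimeFermionInteraction 1 0 U) 1 = energyDensityTT' 1 0 U (13 / 10)) :
    Tendsto (fun M : ℕ =>
        (ω.expect (halfOpenBox 2 M) (etaRaise (fun w : PolySite (halfOpenBox 2 M) => siteStagger (ofLex w.1)) *
          etaLower (fun w : PolySite (halfOpenBox 2 M) => siteStagger (ofLex w.1)))).re / (M : ℝ) ^ 4)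
        atTop (𝓝 0) ∧
      ∀ {Λ Λ' : Finset (Site 2)}, Λ ⊆ Λ' → thicken Λ 1 ⊆ Λ' →
        (ω.expect Λ (etaRaise (fun w : PolySite Λ => siteStagger (ofLex w.1)) *
            etaLower (fun w : PolySite Λ => siteStagger (ofLex w.1)))).re ≤
          64 * ((#Λ' : ℝ) - #Λ) ^ 2 / ((0.6183229 : ℝ) - 2 / 3 * U) ^ 2 + (3 / 10) * #Λ := by
  have hgap := sub_two_mul_chemPotPlusTT'_n7o10_ge hU
  have hmpos : (0 : ℝ) < (0.6183229 : ℝ) - 2 / 3 * U := by linarith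
  have h := etaPairing_exclusion_mirror (U := U) (m := 7 / 10) (c := (0.6183229 : ℝ) - 2 / 3 * U) hU (by norm_num) (by norm_num)
    (fun {ω'} hω' hρ' hme' => by
      refine ⟨tendsto_etaPairing_boxLRO_of_chemPotPlus_lt hU (by norm_num) (by norm_num) (by linarith) hω' hρ' hme',
        fun hΛ h8 => ?_⟩
      have h := re_expect_etaRaise_mul_etaLower_le_of_chemPotPlus_le (U := U) (n := 7 / 10)
        (m := chemPotPlusTT' 1 0 U (7 / 10)) hU (by norm_num) (by norm_num) le_rfl (by linarith) hω' hρ' hme' hΛ h8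
      refine h.trans (div_le_div_of_nonneg_left (by positivity) (by positivity) ?_)
      exact pow_le_pow_left₀ hmpos.le hgap 2)
    (ω := ω) hω (by rw [hρ]; norm_num) (by rw [hme]; norm_num)
  refine ⟨h.1, fun hΛ h8 => (h.2 hΛ h8).trans (le_of_eq ?_)⟩
  norm_num

/-- **η-PAIRING ODLRO IS ABSENT IN THE MIRRORED WEAK-COUPLING WINDOW AT `n = 5 / 4`** (`0 ≤ U < 0.4846219`; the part-2 margin
`(0.4846219 : ℝ) - U` at density `3 / 4` transported by the generic mirror `etaPairing_exclusion_mirror`): `M⁻⁴ Re ω(η†η) → 0` and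
`Re ω(η†_Λ η_Λ) ≤ 64(|Λ'| − |Λ|)²/margin² + (1 / 4)|Λ|`. [cite: Yang1989, eqs. (6)–(8)] [cite: BratteliRobinsonII1997, Prop. 5.3.19]
[cite: LiebPRL1989, proof of Theorem 2] -/
theorem etaPairing_exclusion_n5o4_weakCoupling {U : ℝ} (hU : 0 ≤ U) (hUw : U < 0.4846219)
    {ω : InfVolFermionState 2} (hω : ω.IsTranslationInvariant) (hρ : ω.density = 5 / 4)
    (hme : ω.meanEnergy (hubbardTTPrimeFermionInteraction 1 0 U) 1 = energyDensityTT' 1 0 U (5 / 4)) :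
    Tendsto (fun M : ℕ =>
        (ω.expect (halfOpenBox 2 M) (etaRaise (fun w : PolySite (halfOpenBox 2 M) => siteStagger (ofLex w.1)) *
          etaLower (fun w : PolySite (halfOpenBox 2 M) => siteStagger (ofLex w.1)))).re / (M : ℝ) ^ 4)
        atTop (𝓝 0) ∧
      ∀ {Λ Λ' : Finset (Site 2)}, Λ ⊆ Λ' → thicken Λ 1 ⊆ Λ' →
        (ω.expect Λ (etaRaise (fun w : PolySite Λ => siteStagger (ofLex w.1)) *
            etaLower (fun w : PolySite Λ => siteStagger (ofLex w.1)))).re ≤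
          64 * ((#Λ' : ℝ) - #Λ) ^ 2 / ((0.4846219 : ℝ) - U) ^ 2 + (1 / 4) * #Λ := by
  have hgap := sub_two_mul_chemPotPlusTT'_n3o4_ge hU
  have hmpos : (0 : ℝ) < (0.4846219 : ℝ) - U := by linarith
  have h := etaPairing_exclusion_mirror (U := U) (m := 3 / 4) (c := (0.4846219 : ℝ) - U) hU (by norm_num) (by norm_num)
    (fun {ω'} hω' hρ' hme' => by
      refine ⟨tendsto_etaPairing_boxLRO_of_chemPotPlus_lt hU (by norm_num) (by norm_num) (by linarith) hω' hρ' hme',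
        fun hΛ h8 => ?_⟩
      have h := re_expect_etaRaise_mul_etaLower_le_of_chemPotPlus_le (U := U) (n := 3 / 4)
        (m := chemPotPlusTT' 1 0 U (3 / 4)) hU (by norm_num) (by norm_num) le_rfl (by linarith) hω' hρ' hme' hΛ h8
      refine h.trans (div_le_div_of_nonneg_left (by positivity) (by positivity) ?_)
      exact pow_le_pow_left₀ hmpos.le hgap 2)
    (ω := ω) hω (by rw [hρ]; norm_num) (by rw [hme]; norm_num)
  refine ⟨h.1, fun hΛ h8 => (h.2 hΛ h8).trans (le_of_eq ?_)⟩
  norm_num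

/-- **η-PAIRING ODLRO IS ABSENT IN THE MIRRORED WEAK-COUPLING WINDOW AT `n = 6 / 5`** (`0 ≤ U < 0.2369566`; the part-2 margin
`(0.3554350 : ℝ) - 3 / 2 * U` at density `4 / 5` transported by the generic mirror `etaPairing_exclusion_mirror`): `M⁻⁴ Re ω(η†η) → 0` and
`Re ω(η†_Λ η_Λ) ≤ 64(|Λ'| − |Λ|)²/margin² + (1 / 5)|Λ|`. [cite: Yang1989, eqs. (6)–(8)] [cite: BratteliRobinsonII1997, Prop. 5.3.19]
[cite: LiebPRL1989, proof of Theorem 2] -/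
theorem etaPairing_exclusion_n6o5_weakCoupling {U : ℝ} (hU : 0 ≤ U) (hUw : U < 0.2369566)
    {ω : InfVolFermionState 2} (hω : ω.IsTranslationInvariant) (hρ : ω.density = 6 / 5)
    (hme : ω.meanEnergy (hubbardTTPrimeFermionInteraction 1 0 U) 1 = energyDensityTT' 1 0 U (6 / 5)) :
    Tendsto (fun M : ℕ =>
        (ω.expect (halfOpenBox 2 M) (etaRaise (fun w : PolySite (halfOpenBox 2 M) => siteStagger (ofLex w.1)) *
          etaLower (fun w : PolySite (halfOpenBox 2 M) => siteStagger (ofLex w.1)))).re / (M : ℝ) ^ 4)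
        atTop (𝓝 0) ∧
      ∀ {Λ Λ' : Finset (Site 2)}, Λ ⊆ Λ' → thicken Λ 1 ⊆ Λ' →
        (ω.expect Λ (etaRaise (fun w : PolySite Λ => siteStagger (ofLex w.1)) *
            etaLower (fun w : PolySite Λ => siteStagger (ofLex w.1)))).re ≤
          64 * ((#Λ' : ℝ) - #Λ) ^ 2 / ((0.3554350 : ℝ) - 3 / 2 * U) ^ 2 + (1 / 5) * #Λ := by
  have hgap := sub_two_mul_chemPotPlusTT'_n4o5_ge hU
  have hmpos : (0 : ℝ) < (0.3554350 : ℝ) - 3 / 2 * U := by linarith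
  have h := etaPairing_exclusion_mirror (U := U) (m := 4 / 5) (c := (0.3554350 : ℝ) - 3 / 2 * U) hU (by norm_num) (by norm_num)
    (fun {ω'} hω' hρ' hme' => by
      refine ⟨tendsto_etaPairing_boxLRO_of_chemPotPlus_lt hU (by norm_num) (by norm_num) (by linarith) hω' hρ' hme',
        fun hΛ h8 => ?_⟩
      have h := re_expect_etaRaise_mul_etaLower_le_of_chemPotPlus_le (U := U) (n := 4 / 5)
        (m := chemPotPlusTT' 1 0 U (4 / 5)) hU (by norm_num) (by norm_num) le_rfl (by linarith) hω' hρ' hme' hΛ h8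
      refine h.trans (div_le_div_of_nonneg_left (by positivity) (by positivity) ?_)
      exact pow_le_pow_left₀ hmpos.le hgap 2)
    (ω := ω) hω (by rw [hρ]; norm_num) (by rw [hme]; norm_num)
  refine ⟨h.1, fun hΛ h8 => (h.2 hΛ h8).trans (le_of_eq ?_)⟩
  norm_num

/-- **η-PAIRING ODLRO IS ABSENT IN THE MIRRORED WEAK-COUPLING WINDOW AT `n = 9 / 8`** (`0 ≤ U < 0.0574649`; the part-2 margin
`(0.1723948 : ℝ) - 3 * U` at density `7 / 8` transported by the generic mirror `etaPairing_exclusion_mirror`): `M⁻⁴ Re ω(η†η) → 0` and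
`Re ω(η†_Λ η_Λ) ≤ 64(|Λ'| − |Λ|)²/margin² + (1 / 8)|Λ|`. [cite: Yang1989, eqs. (6)–(8)] [cite: BratteliRobinsonII1997, Prop. 5.3.19]
[cite: LiebPRL1989, proof of Theorem 2] -/
theorem etaPairing_exclusion_n9o8_weakCoupling {U : ℝ} (hU : 0 ≤ U) (hUw : U < 0.0574649)
    {ω : InfVolFermionState 2} (hω : ω.IsTranslationInvariant) (hρ : ω.density = 9 / 8)
    (hme : ω.meanEnergy (hubbardTTPrimeFermionInteraction 1 0 U) 1 = energyDensityTT' 1 0 U (9 / 8)) :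
    Tendsto (fun M : ℕ =>
        (ω.expect (halfOpenBox 2 M) (etaRaise (fun w : PolySite (halfOpenBox 2 M) => siteStagger (ofLex w.1)) *
          etaLower (fun w : PolySite (halfOpenBox 2 M) => siteStagger (ofLex w.1)))).re / (M : ℝ) ^ 4)
        atTop (𝓝 0) ∧
      ∀ {Λ Λ' : Finset (Site 2)}, Λ ⊆ Λ' → thicken Λ 1 ⊆ Λ' →
        (ω.expect Λ (etaRaise (fun w : PolySite Λ => siteStagger (ofLex w.1)) *
            etaLower (fun w : PolySite Λ => siteStagger (ofLex w.1)))).re ≤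
          64 * ((#Λ' : ℝ) - #Λ) ^ 2 / ((0.1723948 : ℝ) - 3 * U) ^ 2 + (1 / 8) * #Λ := by
  have hgap := sub_two_mul_chemPotPlusTT'_n7o8_ge hU
  have hmpos : (0 : ℝ) < (0.1723948 : ℝ) - 3 * U := by linarith
  have h := etaPairing_exclusion_mirror (U := U) (m := 7 / 8) (c := (0.1723948 : ℝ) - 3 * U) hU (by norm_num) (by norm_num)
    (fun {ω'} hω' hρ' hme' => by
      refine ⟨tendsto_etaPairing_boxLRO_of_chemPotPlus_lt hU (by norm_num) (by norm_num) (by linarith) hω' hρ' hme',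
        fun hΛ h8 => ?_⟩
      have h := re_expect_etaRaise_mul_etaLower_le_of_chemPotPlus_le (U := U) (n := 7 / 8)
        (m := chemPotPlusTT' 1 0 U (7 / 8)) hU (by norm_num) (by norm_num) le_rfl (by linarith) hω' hρ' hme' hΛ h8
      refine h.trans (div_le_div_of_nonneg_left (by positivity) (by positivity) ?_)
      exact pow_le_pow_left₀ hmpos.le hgap 2)
    (ω := ω) hω (by rw [hρ]; norm_num) (by rw [hme]; norm_num)
  refine ⟨h.1, fun hΛ h8 => (h.2 hΛ h8).trans (le_of_eq ?_)⟩
  norm_num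

end Summit.Ventures.CertifiedManyBodySolver.Observables

end
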